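import Literature.Geometry.Lorentzian.TeukolskyStarobinskyHeun
import Literature.Geometry.Lorentzian.TeukolskyWronskianBound
import Literature.Analysis.ODE.RegularSingularScalarBranch
import Literature.Analysis.ODE.LinearSecondOrder
import HarnessLib

/-!
# Existence of the horizon-normalised radial solution `R_{𝓗⁺}` (Teixeira da Costa 2020, Def. 2.3),
# scalar case `s = 0`, subextremal Kerr `|a| < M`

Namespace `Literature.Geometry.Lorentzian.Kerr`. For `M > 0`, `|a| < M`, real `ω`, `m`, `λ`, this file
PROVES the existence of a classical solution `R` of the homogeneous radial Teukolsky ODE with `s = 0`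
(`Kerr.IsRadialTeukolskySolution M a 0 ω m λ R`, `TeukolskyRealAxisModeStability.lean`) which is
normalised at the event horizon in the sense of `Kerr.IsNormalisedHorizonSolution`
(`TeukolskyWronskianBound.lean`; TdC Def. 2.3: `R(r)(r − r₊)^{−ξ}` smooth at `r = r₊` and
`|((r² + a²)^{1/2} (r − r₊)^{−ξ} R)(r₊)| = 1`): `Kerr.exists_normalisedHorizonSolution`. The source
(R. Teixeira da Costa, CMP 378 (2020) = arXiv:1910.02854, Def. 2.3 / Lemma 2.2; likewise DRSR
arXiv:1402.7034 §5.3, `u_hor`) calls this "standard ODE theory"; here it is assembled from the tree: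
(1) in the confluent-Heun normalisation `g = heunWeight · R` of `TeukolskyRadialHeunForm.lean` the radial
ODE reads `Δ g″ + P g′ + Q g = 0`, and divided by `r − r₋` it is `x g″ + p(x) g′ + q(x) g = 0`,
`x = r − r₊`, with `p`, `q` holomorphic on `‖x‖ < r₊ − r₋` (`Costa2019.horizonP/Q`, geometric series) and
`p(0) = 2ξ + 1`, `Re ξ = 0`, so the non-resonant Frobenius theorem
`Literature.Analysis.ODE.exists_analyticBranch_scalar` (`‖n + p₀‖ ≥ n + 1`) gives a solution HOLOMORPHIC at
`r₊` with prescribed `g(r₊)` (`exists_local_heunSolution`); (2) it is continued to `(r₊, ∞)` by global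
existence/uniqueness for the linear ODE (`Literature.Analysis.ODE.exists_solution_Ioi`,
`eqOn_of_solution_Ioo`) and `R := heunWeight⁻¹ g` solves the radial ODE
(`Costa2019.isRadialTeukolskySolution_of_heun`); (3) `R (r − r₊)^{−ξ} = e^{−iωr} (r − r₋)^{η} g` is smooth
on a two-sided neighbourhood of `r₊` and `g(r₊) = (r₊² + a²)^{−1/2}` gives the normalisation
(`Re η = 0`). Companion: `TeukolskyNormalisedInfinityExists.lean` (the solution normalised at `𝓘⁺`).

## References
* R. Teixeira da Costa, *Mode stability for the Teukolsky equation on extremal and subextremal Kerr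
  spacetimes*, CMP 378 (2020) 705–781 = arXiv:1910.02854, Def. 2.3, Lemma 2.2, §3.2. [Costa2019]
* E. A. Coddington, N. Levinson, *Theory of Ordinary Differential Equations* (1955), Ch. 4.
  [CoddingtonLevinson1955]
-/

noncomputable section

open Complex Set Filter Metric

namespace Literature.Geometry.Lorentzian.Kerr

namespace Costa2019

/-! ### The Heun coefficients at `r₊` as holomorphic functions of `x = r − r₊` -/

/-- The coefficients `(−1)ᵏ/d^{k+1}` of `1/(x + d) = Σ (−1)ᵏ xᵏ/d^{k+1}` (`‖x‖ < d`). [folklore] -/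
def invShiftCoeff (d : ℝ) (k : ℕ) : ℂ := (d : ℂ)⁻¹ * (-(d : ℂ)⁻¹) ^ k

/-- `Σ xᵏ (−1)ᵏ/d^{k+1} = 1/(x + d)` for `‖x‖ < d` (`d > 0`). [folklore] -/
theorem hasSum_invShiftCoeff {d : ℝ} (hd : 0 < d) {x : ℂ} (hx : ‖x‖ < d) :
    HasSum (fun k : ℕ => x ^ k * invShiftCoeff d k) ((x + d)⁻¹) := by
  have hd0 : (d : ℂ) ≠ 0 := by exact_mod_cast hd.ne'
  have hξ : ‖-(x / d)‖ < 1 := by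
    rw [norm_neg, norm_div, Complex.norm_real, Real.norm_of_nonneg hd.le, div_lt_one hd]
    exact hx
  have hg := (hasSum_geometric_of_norm_lt_one hξ).mul_left ((d : ℂ)⁻¹)
  have hne : (x + d) ≠ 0 := by
    intro h
    have : ‖x‖ = d := by
      rw [show x = -(d : ℂ) by linear_combination h, norm_neg, Complex.norm_real, Real.norm_of_nonneg hd.le]
    linarith
  have hf : ∀ k : ℕ, x ^ k * invShiftCoeff d k = (d : ℂ)⁻¹ * (-(x / d)) ^ k := fun k => by
    rw [invShiftCoeff, div_eq_mul_inv, ← mul_neg, mul_pow]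
    ring
  have hv : (d : ℂ)⁻¹ * (1 - -(x / d))⁻¹ = (x + d)⁻¹ := by
    rw [← mul_inv]
    congr 1
    field_simp
    ring
  rw [← hv]
  exact hg.congr_fun hf

/-- `‖(−1)ᵏ/d^{k+1}‖ = d⁻¹ (d⁻¹)ᵏ`. [folklore] -/
theorem norm_invShiftCoeff {d : ℝ} (hd : 0 < d) (k : ℕ) : ‖invShiftCoeff d k‖ = d⁻¹ * d⁻¹ ^ k := by
  rw [invShiftCoeff, norm_mul, norm_pow, norm_neg, norm_inv, Complex.norm_real, Real.norm_of_nonneg hd.le]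

variable (M a ω m lam : ℝ)

/-- `p(x) = (2ξ + 2η + 2) − 2iω x − (2η + 1)(r₊ − r₋)/(x + r₊ − r₋)`: the coefficient of `g′` in
`x g″ + p g′ + q g = 0`, the `s = 0` confluent Heun equation `Δ g″ + P g′ + Q g = 0` divided by `r − r₋`
(`x = r − r₊`). [cite: Costa2019, §3.2.2 (confluent-operator)] -/
def horizonP (x : ℂ) : ℂ :=
  (2 * horizonExponent M a ω m + 2 * innerExponent M a ω m + 2) - 2 * I * ω * x +
    (-(2 * innerExponent M a ω m + 1) * ((rPlus M a - rMinus M a : ℝ) : ℂ)) *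
      (x + ((rPlus M a - rMinus M a : ℝ) : ℂ))⁻¹

/-- `q(x) = −2iω + (−2iω r₋ − L)/(x + r₊ − r₋)`, `L = λ + a²ω² − 2amω`: the coefficient of `g`.
[cite: Costa2019, §3.2.2 (confluent-operator)] -/
def horizonQ (x : ℂ) : ℂ :=
  -(2 * I * ω) + (-(2 * I * ω * rMinus M a) - ((lam + a ^ 2 * ω ^ 2 - 2 * a * m * ω : ℝ) : ℂ)) *
    (x + ((rPlus M a - rMinus M a : ℝ) : ℂ))⁻¹

/-- The Taylor coefficients of `horizonP` at `x = 0`. [folklore] -/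
def horizonPCoeff (k : ℕ) : ℂ :=
  (if k = 0 then 2 * horizonExponent M a ω m + 2 * innerExponent M a ω m + 2 else 0) +
    (if k = 1 then -(2 * I * ω) else 0) +
    (-(2 * innerExponent M a ω m + 1) * ((rPlus M a - rMinus M a : ℝ) : ℂ)) *
      invShiftCoeff (rPlus M a - rMinus M a) k

/-- The Taylor coefficients of `horizonQ` at `x = 0`. [folklore] -/
def horizonQCoeff (k : ℕ) : ℂ :=
  (if k = 0 then -(2 * I * ω) else 0) +
    (-(2 * I * ω * rMinus M a) - ((lam + a ^ 2 * ω ^ 2 - 2 * a * m * ω : ℝ) : ℂ)) *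
      invShiftCoeff (rPlus M a - rMinus M a) k

variable {M a}

/-- `Σ xᵏ pₖ = p(x)` on `‖x‖ < r₊ − r₋`. [folklore] -/
theorem hasSum_horizonP (ha : |a| < M) {x : ℂ} (hx : ‖x‖ < rPlus M a - rMinus M a) :
    HasSum (fun k : ℕ => x ^ k * horizonPCoeff M a ω m k) (horizonP M a ω m x) := by
  have hd : 0 < rPlus M a - rMinus M a := sub_pos.2 (IsSubextremal.rMinus_lt_rPlus ha)
  have h0 : HasSum (fun k : ℕ => x ^ k * (if k = 0 then
      2 * horizonExponent M a ω m + 2 * innerExponent M a ω m + 2 else 0))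
      (2 * horizonExponent M a ω m + 2 * innerExponent M a ω m + 2) := by
    simpa using hasSum_single (f := fun k : ℕ => x ^ k * (if k = 0 then
      2 * horizonExponent M a ω m + 2 * innerExponent M a ω m + 2 else 0)) 0 (fun k hk => by simp [hk])
  have h1 : HasSum (fun k : ℕ => x ^ k * (if k = 1 then -(2 * I * ω) else 0)) (-(2 * I * ω * x)) := by
    have := hasSum_single (f := fun k : ℕ => x ^ k * (if k = 1 then -(2 * I * ω) else 0)) 1
      (fun k hk => by simp [hk])
    simp only [↓reduceIte, pow_one] at this
    rwa [show -(2 * I * ω * x) = x * -(2 * I * ω) by ring]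
  convert (h0.add h1).add ((hasSum_invShiftCoeff hd hx).mul_left
    (-(2 * innerExponent M a ω m + 1) * ((rPlus M a - rMinus M a : ℝ) : ℂ))) using 1
  · funext k
    simp only [horizonPCoeff]
    ring
  · simp only [horizonP]
    ring

/-- `Σ xᵏ qₖ = q(x)` on `‖x‖ < r₊ − r₋`. [folklore] -/
theorem hasSum_horizonQ (ha : |a| < M) {x : ℂ} (hx : ‖x‖ < rPlus M a - rMinus M a) :
    HasSum (fun k : ℕ => x ^ k * horizonQCoeff M a ω m lam k) (horizonQ M a ω m lam x) := by
  have hd : 0 < rPlus M a - rMinus M a := sub_pos.2 (IsSubextremal.rMinus_lt_rPlus ha)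
  have h0 : HasSum (fun k : ℕ => x ^ k * (if k = 0 then -(2 * I * ω) else 0)) (-(2 * I * ω)) := by
    simpa using hasSum_single (f := fun k : ℕ => x ^ k * (if k = 0 then -(2 * I * ω) else 0)) 0
      (fun k hk => by simp [hk])
  convert h0.add ((hasSum_invShiftCoeff hd hx).mul_left
    (-(2 * I * ω * rMinus M a) - ((lam + a ^ 2 * ω ^ 2 - 2 * a * m * ω : ℝ) : ℂ))) using 1
  · funext k
    simp only [horizonQCoeff]
    ring
  · simp only [horizonQ]

/-- `p₀ = 2ξ + 1` (the indicial data at `r₊`: exponents `0` and `1 − p₀ = −2ξ`). [cite: Costa2019, §3.2 (g-bdry-sub)] -/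
theorem horizonPCoeff_zero (ha : |a| < M) : horizonPCoeff M a ω m 0 = 2 * horizonExponent M a ω m + 1 := by
  have hd : 0 < rPlus M a - rMinus M a := sub_pos.2 (IsSubextremal.rMinus_lt_rPlus ha)
  have hd0 : ((rPlus M a - rMinus M a : ℝ) : ℂ) ≠ 0 := by exact_mod_cast hd.ne'
  simp only [horizonPCoeff, invShiftCoeff, ↓reduceIte, Nat.zero_ne_one, pow_zero, mul_one, add_zero]
  field_simp
  ring

/-- NON-RESONANCE at `r₊`: `‖n + p₀‖ ≥ n + 1` since `Re p₀ = 1` (`Re ξ = 0`). [cite: Costa2019, §3.2 (g-bdry-sub)] -/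
theorem norm_natCast_add_horizonPCoeff_zero (ha : |a| < M) (n : ℕ) :
    (1 : ℝ) * n ≤ ‖(n : ℂ) + horizonPCoeff M a ω m 0‖ := by
  rw [horizonPCoeff_zero ω m ha, one_mul]
  refine le_trans ?_ (Complex.re_le_norm _)
  simp [Complex.add_re, horizonExponent_re]

/-- `p₀ ≠ 0`. [folklore] -/
theorem horizonPCoeff_zero_ne_zero (ha : |a| < M) : horizonPCoeff M a ω m 0 ≠ 0 := by
  intro h
  have h2 : (horizonPCoeff M a ω m 0).re = 1 := by
    rw [horizonPCoeff_zero ω m ha]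
    simp [Complex.add_re, horizonExponent_re]
  rw [h] at h2
  simp at h2

/-- GEOMETRIC BOUNDS `‖pₖ‖, ‖qₖ‖ ≤ K d⁻ᵏ` for `k ≥ 1`, `d = r₊ − r₋`. [folklore] -/
theorem norm_horizonCoeff_le (ha : |a| < M) :
    ∃ K : ℝ, 0 ≤ K ∧ (∀ k : ℕ, 1 ≤ k → ‖horizonPCoeff M a ω m k‖ ≤ K * (rPlus M a - rMinus M a)⁻¹ ^ k) ∧
      ∀ k : ℕ, 1 ≤ k → ‖horizonQCoeff M a ω m lam k‖ ≤ K * (rPlus M a - rMinus M a)⁻¹ ^ k := by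
  have hd : 0 < rPlus M a - rMinus M a := sub_pos.2 (IsSubextremal.rMinus_lt_rPlus ha)
  set d := rPlus M a - rMinus M a with hdd
  set B : ℂ := -(2 * innerExponent M a ω m + 1) * ((d : ℝ) : ℂ) with hB
  set Cq : ℂ := -(2 * I * ω * rMinus M a) - ((lam + a ^ 2 * ω ^ 2 - 2 * a * m * ω : ℝ) : ℂ) with hCq
  refine ⟨2 * |ω| * d + ‖B‖ * d⁻¹ + ‖Cq‖ * d⁻¹, by positivity, fun k hk => ?_, fun k hk => ?_⟩
  · have hk0 : k ≠ 0 := by omega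
    have e : horizonPCoeff M a ω m k = (if k = 1 then -(2 * I * ω) else 0) + B * invShiftCoeff d k := by
      simp only [horizonPCoeff, hk0, ↓reduceIte, zero_add, hB, hdd]
    rw [e]
    refine (norm_add_le _ _).trans ?_
    rw [norm_mul, norm_invShiftCoeff hd]
    have hdk : 0 < d⁻¹ ^ k := pow_pos (inv_pos.2 hd) k
    rcases eq_or_ne k 1 with rfl | hk1
    · simp only [↓reduceIte, norm_neg, norm_mul, Complex.norm_ofNat, Complex.norm_I, mul_one,
        Complex.norm_real, Real.norm_eq_abs, pow_one]
      have : 2 * |ω| = 2 * |ω| * d * d⁻¹ := by field_simp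
      nlinarith [norm_nonneg B, norm_nonneg Cq, inv_pos.2 hd, mul_nonneg (norm_nonneg Cq) (inv_pos.2 hd).le]
    · simp only [hk1, ↓reduceIte, norm_zero, zero_add]
      have h1 : ‖B‖ * (d⁻¹ * d⁻¹ ^ k) = ‖B‖ * d⁻¹ * d⁻¹ ^ k := by ring
      rw [h1]
      refine mul_le_mul_of_nonneg_right ?_ hdk.le
      nlinarith [norm_nonneg Cq, inv_pos.2 hd, abs_nonneg ω, mul_nonneg (norm_nonneg Cq) (inv_pos.2 hd).le]
  · have hk0 : k ≠ 0 := by omega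
    have e : horizonQCoeff M a ω m lam k = Cq * invShiftCoeff d k := by
      simp only [horizonQCoeff, hk0, ↓reduceIte, zero_add, hCq, hdd]
    rw [e, norm_mul, norm_invShiftCoeff hd]
    have hdk : 0 < d⁻¹ ^ k := pow_pos (inv_pos.2 hd) k
    have h1 : ‖Cq‖ * (d⁻¹ * d⁻¹ ^ k) = ‖Cq‖ * d⁻¹ * d⁻¹ ^ k := by ring
    rw [h1]
    refine mul_le_mul_of_nonneg_right ?_ hdk.le
    nlinarith [norm_nonneg B, inv_pos.2 hd, abs_nonneg ω, mul_nonneg (norm_nonneg B) (inv_pos.2 hd).le]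

/-- THE DIVISION BY `r − r₋`: for real `r`, with `x = r − r₊`,
`(r − r₋) p(x) = P(r)` and `(r − r₋) q(x) = Q(r)` (`P = heunP M a 0 ω m`, `Q = heunQ a 0 ω m λ`).
[cite: Costa2019, §3.2.2 (confluent-operator)] -/
theorem horizonPQ_mul (hM : 0 < M) (ha : |a| < M) {r : ℝ} (hr : rMinus M a < r) :
    ((r - rMinus M a : ℝ) : ℂ) * horizonP M a ω m ((r : ℂ) - rPlus M a) = heunP M a 0 ω m r ∧
      ((r - rMinus M a : ℝ) : ℂ) * horizonQ M a ω m lam ((r : ℂ) - rPlus M a) = heunQ a 0 ω m lam r := by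
  have hne : (r : ℂ) - (rMinus M a : ℂ) ≠ 0 := by
    rw [← Complex.ofReal_sub]; exact_mod_cast (sub_pos.2 hr).ne'
  have _ := hM
  constructor
  · unfold horizonP heunP
    rw [delta_eq_mul ha.le]
    push_cast
    have e : (r : ℂ) - rPlus M a + (rPlus M a - rMinus M a) = r - rMinus M a := by ring
    rw [e]
    field_simp
    ring
  · unfold horizonQ heunQ
    push_cast
    have e : (r : ℂ) - rPlus M a + (rPlus M a - rMinus M a) = r - rMinus M a := by ring
    rw [e]
    field_simp
    ring

/-- **The horizon-regular branch of `𝒯_r g = 0` (`s = 0`).** For every `g₀ : ℂ` there are `ε > 0`, a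
function `y` holomorphic on the disc `‖x‖ < ε` with `y 0 = g₀`, and `g₁ g₂ : ℝ → ℂ`, such that
`g(r) := y(r − r₊)` solves `Δ g″ + P g′ + Q g = 0` classically on `(r₊, r₊ + ε)` with `g′ = g₁`,
`g₁′ = g₂`; moreover `ε ≤ r₊ − r₋`. (Frobenius at the regular singular point `r₊`, exponent `0`,
non-resonant because `Re(2ξ + 1) = 1`.) [cite: Costa2019, Lemma 2.2 and §3.2 (g-bdry-sub)] -/
theorem exists_local_heunSolution (hM : 0 < M) (ha : |a| < M) (g₀ : ℂ) :
    ∃ ε : ℝ, 0 < ε ∧ ε ≤ rPlus M a - rMinus M a ∧ ∃ y : ℂ → ℂ, y 0 = g₀ ∧ DifferentiableOn ℂ y (ball 0 ε) ∧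
      ∃ g₁ g₂ : ℝ → ℂ, ∀ r ∈ Ioo (rPlus M a) (rPlus M a + ε),
        HasDerivAt (fun t : ℝ => y ((t : ℂ) - rPlus M a)) (g₁ r) r ∧ HasDerivAt g₁ (g₂ r) r ∧
          (delta M a r : ℂ) * g₂ r + heunP M a 0 ω m r * g₁ r + heunQ a 0 ω m lam r * y ((r : ℂ) - rPlus M a) = 0 := by
  have hd : 0 < rPlus M a - rMinus M a := sub_pos.2 (IsSubextremal.rMinus_lt_rPlus ha)
  set d := rPlus M a - rMinus M a with hdd
  obtain ⟨K, hK, hPc, hQc⟩ := norm_horizonCoeff_le ω m lam ha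
  have hp0 := horizonPCoeff_zero_ne_zero ω m ha
  set y₁ : ℂ := -(horizonQCoeff M a ω m lam 0 * g₀) / horizonPCoeff M a ω m 0 with hy₁
  have hcompat : horizonQCoeff M a ω m lam 0 * g₀ + horizonPCoeff M a ω m 0 * y₁ = 0 := by
    rw [hy₁]; field_simp; ring
  obtain ⟨ρ, hρ, y, y', hy0, -, hyd, hy'd, hder, hode⟩ :=
    Literature.Analysis.ODE.exists_analyticBranch_scalar (inv_pos.2 hd) hK one_pos hd hPc hQc
      (fun n _ => norm_natCast_add_horizonPCoeff_zero ω m ha n) (fun x hx => hasSum_horizonP ω m ha hx)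
      (fun x hx => hasSum_horizonQ ω m lam ha hx) hcompat
  set ε := min ρ d with hε
  have hερ : ε ≤ ρ := min_le_left _ _
  have hεd : ε ≤ d := min_le_right _ _
  refine ⟨ε, lt_min hρ hd, hεd, y, hy0, hyd.mono (Metric.ball_subset_ball hερ),
    fun r => y' ((r : ℂ) - rPlus M a), fun r => deriv y' ((r : ℂ) - rPlus M a), fun r hr => ?_⟩
  have hx0 : (r : ℂ) - rPlus M a ≠ 0 := by
    rw [← Complex.ofReal_sub]; exact_mod_cast (sub_pos.2 hr.1).ne'
  have hxn : ‖(r : ℂ) - rPlus M a‖ < ρ := by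
    rw [← Complex.ofReal_sub, Complex.norm_real, Real.norm_of_nonneg (sub_pos.2 hr.1).le]
    linarith [hr.2]
  have hxball : (r : ℂ) - rPlus M a ∈ ball (0 : ℂ) ρ := by
    rwa [Metric.mem_ball, dist_zero_right]
  have hshift : HasDerivAt (fun t : ℝ => (t : ℂ) - rPlus M a) 1 r := by
    simpa using ((hasDerivAt_id (r : ℂ)).sub_const (rPlus M a : ℂ)).comp_ofReal
  refine ⟨?_, ?_, ?_⟩
  · have h := (hder _ hxn hx0).scomp r hshift
    simpa [Function.comp_def] using h
  · have h := ((hy'd _ hxball).differentiableAt (Metric.isOpen_ball.mem_nhds hxball)).hasDerivAt.scomp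
      r hshift
    simpa [Function.comp_def] using h
  · have hq : rMinus M a < r := (rMinus_le_rPlus M a).trans_lt hr.1
    obtain ⟨eP, eQ⟩ := horizonPQ_mul ω m lam hM ha hq
    have key := hode _ hxn
    have e : ((delta M a r : ℝ) : ℂ) = ((r - rMinus M a : ℝ) : ℂ) * ((r : ℂ) - rPlus M a) := by
      rw [delta_eq_mul ha.le]; push_cast; ring
    rw [← eP, ← eQ, e]
    linear_combination ((r - rMinus M a : ℝ) : ℂ) * key

end Costa2019

open Costa2019 in
/-- **Existence of `R_{𝓗⁺}` (Teixeira da Costa Def. 2.3, `s = 0`, `|a| < M`).** For `M > 0`, `|a| < M`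
and real `ω, m, λ` there is a classical solution `R` of the homogeneous radial Teukolsky ODE (`s = 0`) on
`(r₊, ∞)` normalised at `𝓗⁺`: `R(r)(r − r₊)^{−ξ}` extends to a smooth `f` near `r₊` with
`|f(r₊)| (r₊² + a²)^{1/2} = 1` (Lemma 2.2: "defined by a convergent Frobenius series at `r = r₊`").
Construction: Frobenius branch of the confluent Heun form at `r₊` (`exists_local_heunSolution`), global
continuation by linear ODE theory, `R = heunWeight⁻¹ g`. [cite: Costa2019, Definition 2.3 and Lemma 2.2] -/
theorem exists_normalisedHorizonSolution {M a : ℝ} (hM : 0 < M) (ha : |a| < M) (ω m lam : ℝ) :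
    ∃ R : ℝ → ℂ, IsRadialTeukolskySolution M a 0 ω m lam R ∧ IsNormalisedHorizonSolution M a 0 ω m R := by
  have hd : 0 < rPlus M a - rMinus M a := sub_pos.2 (IsSubextremal.rMinus_lt_rPlus ha)
  have hrp : 0 < rPlus M a := rPlus_pos hM a
  have hS : 0 < Real.sqrt (rPlus M a ^ 2 + a ^ 2) := Real.sqrt_pos.2 (by positivity)
  -- Step 1: the local holomorphic solution with `g(r₊) = (r₊² + a²)^{-1/2}`
  obtain ⟨ε, hε, hεd, y, hy0, hyd, g₁, g₂, hloc⟩ :=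
    exists_local_heunSolution ω m lam hM ha (((Real.sqrt (rPlus M a ^ 2 + a ^ 2))⁻¹ : ℝ) : ℂ)
  set g : ℝ → ℂ := fun t => y ((t : ℂ) - rPlus M a) with hg
  -- Step 2: the normal form `u″ = p̃ u′ + q̃ u` on `(r₊, ∞)` and the global continuation
  set pt : ℝ → ℂ := fun r => -heunP M a 0 ω m r / (delta M a r : ℂ) with hpt
  set qt : ℝ → ℂ := fun r => -heunQ a 0 ω m lam r / (delta M a r : ℂ) with hqt
  have hΔ0 : ∀ r ∈ Ioi (rPlus M a), ((delta M a r : ℝ) : ℂ) ≠ 0 := fun r hr => by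
    exact_mod_cast (delta_pos ha.le hr).ne'
  have hΔc : Continuous fun r : ℝ => ((delta M a r : ℝ) : ℂ) :=
    Complex.continuous_ofReal.comp (continuous_iff_continuousAt.2 fun x => (hasDerivAt_delta M a x).continuousAt)
  have hPc : Continuous (heunP M a 0 ω m) :=
    continuous_iff_continuousAt.2 fun x => (hasDerivAt_heun_coeffs M a 0 ω m lam x).1.continuousAt
  have hQc : Continuous (heunQ a 0 ω m lam) :=
    continuous_iff_continuousAt.2 fun x => (hasDerivAt_heun_coeffs M a 0 ω m lam x).2.continuousAt
  have hptc : ContinuousOn pt (Ioi (rPlus M a)) := hPc.neg.continuousOn.div hΔc.continuousOn hΔ0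
  have hqtc : ContinuousOn qt (Ioi (rPlus M a)) := hQc.neg.continuousOn.div hΔc.continuousOn hΔ0
  set t₀ : ℝ := rPlus M a + ε / 2 with ht₀
  have ht₀p : rPlus M a < t₀ := by rw [ht₀]; linarith
  have ht₀ε : t₀ ∈ Ioo (rPlus M a) (rPlus M a + ε) := ⟨ht₀p, by rw [ht₀]; linarith⟩
  obtain ⟨u, u', hu0, hu1, hu⟩ :=
    Literature.Analysis.ODE.exists_solution_Ioi hptc hqtc t₀ (g t₀) (g₁ t₀)
  -- the local solution solves the same normal form on `(r₊, r₊ + ε)`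
  have hloc' : ∀ r ∈ Ioo (rPlus M a) (rPlus M a + ε),
      HasDerivAt g (g₁ r) r ∧ HasDerivAt g₁ (pt r * g₁ r + qt r * g r) r := by
    intro r hr
    obtain ⟨h1, h2, h3⟩ := hloc r hr
    have hΔ := hΔ0 r hr.1
    have e : g₂ r = pt r * g₁ r + qt r * g r := by
      simp only [hpt, hqt, hg]
      field_simp
      linear_combination h3
    exact ⟨h1, e ▸ h2⟩
  have hsub : Ioo (rPlus M a) (rPlus M a + ε) ⊆ Ioi (rPlus M a) := fun r hr => hr.1
  have hEq := Literature.Analysis.ODE.eqOn_of_solution_Ioo (hptc.mono hsub) (hqtc.mono hsub) ht₀ε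
    (fun r hr => hu r (hsub hr)) hloc' hu0 hu1
  -- the global Heun solution and the radial solution `R = heunWeight⁻¹ u`
  have hHeun : ∀ r, rPlus M a < r → HasDerivAt u (u' r) r ∧ HasDerivAt u' (pt r * u' r + qt r * u r) r ∧
      (delta M a r : ℂ) * (pt r * u' r + qt r * u r) + heunP M a 0 ω m r * u' r +
        heunQ a 0 ω m lam r * u r = 0 := by
    intro r hr
    refine ⟨(hu r hr).1, (hu r hr).2, ?_⟩
    have hΔ := hΔ0 r hr
    simp only [hpt, hqt]
    field_simp
    ring
  set R : ℝ → ℂ := fun r => (heunWeight M a 0 ω m r)⁻¹ * u r with hR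
  have hsol : IsRadialTeukolskySolution M a 0 ω m lam R :=
    isRadialTeukolskySolution_of_heun hM ha 0 ω m lam hHeun
  refine ⟨R, hsol, ?_⟩
  -- Step 3: the normalisation
  refine ⟨ε, hε, fun r => ((r - rMinus M a : ℝ) : ℂ) ^ (-((((0 : ℝ)) : ℂ) - innerExponent M a ω m)) *
    Complex.exp (-(I * ω * r)) * g r, ?_, ?_, ?_⟩
  · -- smoothness on `(r₊ − ε, r₊ + ε)`
    have hball : MapsTo (fun t : ℝ => (t : ℂ) - rPlus M a) (Ioo (rPlus M a - ε) (rPlus M a + ε)) (ball 0 ε) := by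
      intro t ht
      rw [Metric.mem_ball, dist_zero_right]
      show ‖(t : ℂ) - (rPlus M a : ℂ)‖ < ε
      rw [← Complex.ofReal_sub, Complex.norm_real, Real.norm_eq_abs, abs_lt]
      constructor <;> linarith [ht.1, ht.2]
    have hyC : ContDiffOn ℝ ((⊤ : ℕ∞) : WithTop ℕ∞) y (ball 0 ε) :=
      (hyd.contDiffOn Metric.isOpen_ball).restrict_scalars ℝ
    have hshiftC : ContDiff ℝ ((⊤ : ℕ∞) : WithTop ℕ∞) fun t : ℝ => (t : ℂ) - rPlus M a :=
      Complex.ofRealCLM.contDiff.sub contDiff_const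
    have hgC : ContDiffOn ℝ ((⊤ : ℕ∞) : WithTop ℕ∞) g (Ioo (rPlus M a - ε) (rPlus M a + ε)) :=
      hyC.comp hshiftC.contDiffOn hball
    refine ContDiffOn.mul (ContDiffOn.mul ?_ ?_) hgC
    · exact (contDiffOn_ofReal_sub_cpow (rMinus M a) _).mono fun x hx => by
        simp only [mem_Ioi]; linarith [hx.1]
    · exact (Complex.contDiff_exp.comp ((contDiff_const.mul Complex.ofRealCLM.contDiff).neg)).contDiffOn
  · -- the identity `R (r − r₊)^{−ξ} = e^{−iωr} (r − r₋)^{η} g` on `(r₊, r₊ + ε)`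
    intro r hr
    have hr' : rPlus M a < r := hr.1
    have hq : rMinus M a < r := (rMinus_le_rPlus M a).trans_lt hr'
    have hu_eq : u r = g r := hEq.1 hr
    have hune : ((r - rPlus M a : ℝ) : ℂ) ≠ 0 := by exact_mod_cast (sub_pos.2 hr').ne'
    simp only [hR]
    rw [hu_eq]
    simp only [heunWeight, mul_inv]
    have e1 : (((r - rMinus M a : ℝ) : ℂ) ^ ((((0 : ℝ)) : ℂ) - innerExponent M a ω m))⁻¹ =
        ((r - rMinus M a : ℝ) : ℂ) ^ (-((((0 : ℝ)) : ℂ) - innerExponent M a ω m)) :=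
      (Complex.cpow_neg _ _).symm
    have e2 : (Complex.exp (I * ω * r))⁻¹ = Complex.exp (-(I * ω * r)) := (Complex.exp_neg _).symm
    have e3 : (((r - rPlus M a : ℝ) : ℂ) ^ ((((0 : ℝ)) : ℂ) - horizonExponent M a ω m))⁻¹ *
        ((r - rPlus M a : ℝ) : ℂ) ^ ((((0 : ℝ)) : ℂ) - horizonExponent M a ω m) = 1 :=
      inv_mul_cancel₀ (fun h0 => hune ((Complex.cpow_eq_zero_iff _ _).1 h0).1)
    rw [e1, e2]
    linear_combination (((r - rMinus M a : ℝ) : ℂ) ^ (-((((0 : ℝ)) : ℂ) - innerExponent M a ω m)) *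
      Complex.exp (-(I * ω * r)) * g r) * e3
  · -- the value at `r₊`
    have hg0 : g (rPlus M a) = (((Real.sqrt (rPlus M a ^ 2 + a ^ 2))⁻¹ : ℝ) : ℂ) := by
      simp only [hg, sub_self, hy0]
    have hn1 : ‖((rPlus M a - rMinus M a : ℝ) : ℂ) ^ (-((((0 : ℝ)) : ℂ) - innerExponent M a ω m))‖ = 1 := by
      rw [Complex.norm_cpow_eq_rpow_re_of_pos hd]
      simp [innerExponent_re']
    have hn2 : ‖Complex.exp (-(I * ω * (rPlus M a : ℝ)))‖ = 1 := by
      rw [Complex.norm_exp]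
      simp
    rw [norm_mul, norm_mul, hn1, hn2, hg0, Complex.norm_real, Real.norm_of_nonneg (inv_pos.2 hS).le,
      Real.rpow_zero]
    simp only [mul_one, one_mul]
    exact inv_mul_cancel₀ hS.ne'

end Literature.Geometry.Lorentzian.Kerr

end
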